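import Summits.Parity.GeneralizedHardyLittlewood.Theses.ParityWeightedChenSwitching
import Literature.NumberTheory.Sieve.MoebiusShiftedPrimes
import Literature.NumberTheory.Sieve.ParityWave0Proofs
import HarnessLib

/-!
# `MoebiusShiftedPrimesLevel` (stmt-Parity-18663) dominates the open folklore conjecture `μ ⟂ p + 2`

Negative-lane STRENGTH WITNESS for the crux `ParityWeightedChenSwitching.MoebiusShiftedPrimesLevel`
(K1; refuter crux-attack at birth, 2026-08-17): the `m = 1` term of K1's `ℓ¹` sum is
`|∑_{p ≤ x} μ(p + 2)| = |moebiusShiftedPrimeSum 2 x|`, all other terms are non-negative, and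
`x / log² x = O(π(x))` by the prime number theorem (tree, PROVED:
`Literature.NumberTheory.Sieve.tendsto_primeCounting_mul_log_div`). Hence

* `isLittleO_moebiusShiftedPrimeSum_two_of_moebiusShiftedPrimesLevel` :
  K1 → `∑_{p ≤ x} μ(p + 2) = o(x / log² x)` (a full factor `log x` BEYOND the folklore rate `o(π(x))`);
* `moebiusShiftedPrimesConjecture_two_of_moebiusShiftedPrimesLevel` : K1 → the shift-`h = 2` case of
  the registered OPEN conjecture `Literature.NumberTheory.Sieve.MoebiusShiftedPrimesConjecture`
  ("`∑_{p ≤ X} μ(p + h) = o(π(X))` for every fixed `h`"; [status: open] for every single `h` —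
  Lichtman 2020, Thm 1.1 proves only the average over `h ≤ H`, `log H / log log X → ∞`).

So K1 is AT LEAST as hard as an open problem in print (the planner's `difficulty: open-problem` is
earned), and no change of the level `0.499` alters this: the witness is the single modulus `m = 1`,
present at every level `ϑ ≥ 0`. Nothing here asserts a Theses decl; this is a hardness helper on the
`Negative/` lane (`--supports stmt-Parity-18663`). [folklore]
-/

noncomputable section

open scoped BigOperators
open Finset Filter Asymptotics
open Summit.Parity.GeneralizedHardyLittlewood.Theses.ParityWeightedChenSwitching (MoebiusShiftedPrimesLevel)
open Literature.NumberTheory.Sieve (moebiusShiftedPrimeSum MoebiusShiftedPrimesConjecture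
  tendsto_primeCounting_mul_log_div)

namespace Summit.Parity.GeneralizedHardyLittlewood.Theorems.MoebiusShiftedPrimesLevel.Negative

/-- The `m = 1` inner sum of K1 is the Möbius sum over the shifted primes `p + 2`:
`∑_{p ≤ x, 1 ∣ p+2} μ(p + 2) = moebiusShiftedPrimeSum 2 x`. [folklore] -/
theorem innerSum_one_eq_moebiusShiftedPrimeSum (x : ℕ) :
    ∑ p ∈ (Nat.primesLE x).filter (fun p => 1 ∣ p + 2), (ArithmeticFunction.moebius (p + 2) : ℝ)
      = moebiusShiftedPrimeSum 2 x := by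
  unfold moebiusShiftedPrimeSum
  rw [Finset.filter_true_of_mem fun p _ => one_dvd (p + 2)]

/-- For `x ≥ 1` the modulus `m = 1` is in range (`⌊x^0.499⌋ ≥ 1`) and every other term is
non-negative, so `|∑_{p ≤ x} μ(p+2)|` is at most K1's full `ℓ¹` sum. [folklore] -/
theorem abs_moebiusShiftedPrimeSum_two_le_levelSum {x : ℕ} (hx : 1 ≤ x) :
    |moebiusShiftedPrimeSum 2 x| ≤
      ∑ m ∈ Finset.Icc 1 ⌊(x : ℝ) ^ (0.499 : ℝ)⌋₊,
        |∑ p ∈ (Nat.primesLE x).filter (fun p => m ∣ p + 2), (ArithmeticFunction.moebius (p + 2) : ℝ)| := by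
  have h1 : 1 ∈ Finset.Icc 1 ⌊(x : ℝ) ^ (0.499 : ℝ)⌋₊ := by
    rw [Finset.mem_Icc]
    refine ⟨le_rfl, Nat.le_floor ?_⟩
    have hx' : (1 : ℝ) ≤ (x : ℝ) := by exact_mod_cast hx
    rw [Nat.cast_one]
    exact Real.one_le_rpow hx' (by norm_num)
  rw [← innerSum_one_eq_moebiusShiftedPrimeSum]
  exact Finset.single_le_sum
    (f := fun m => |∑ p ∈ (Nat.primesLE x).filter (fun p => m ∣ p + 2),
      (ArithmeticFunction.moebius (p + 2) : ℝ)|) (fun _ _ => abs_nonneg _) h1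

/-- **K1 forces `∑_{p ≤ x} μ(p + 2) = o(x / log² x)`** — its `m = 1` term alone; a rate a full
factor `log x` beyond the folklore `o(π(x))`. [folklore] -/
theorem isLittleO_moebiusShiftedPrimeSum_two_of_moebiusShiftedPrimesLevel
    (h : MoebiusShiftedPrimesLevel) :
    (fun x : ℕ => moebiusShiftedPrimeSum 2 x) =o[atTop] fun x : ℕ => (x : ℝ) / Real.log x ^ 2 := by
  refine IsBigO.trans_isLittleO ?_ h
  refine IsBigO.of_bound 1 ?_
  filter_upwards [eventually_ge_atTop 1] with x hx
  rw [one_mul, Real.norm_eq_abs, Real.norm_eq_abs]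
  exact (abs_moebiusShiftedPrimeSum_two_le_levelSum hx).trans (le_abs_self _)

/-- `x / log² x = O(π(x))` along `ℕ`, from the prime number theorem `π(x) log x / x → 1` PROVED in
the tree (`tendsto_primeCounting_mul_log_div`): eventually `π(x) log x / x ≥ 1/2` and `log x ≥ 1`,
so `x / log² x ≤ x / log x ≤ 2 π(x)`. [folklore] -/
theorem isBigO_div_log_sq_primeCounting :
    (fun x : ℕ => (x : ℝ) / Real.log x ^ 2) =O[atTop] fun x : ℕ => (Nat.primeCounting x : ℝ) := by
  have hev : ∀ᶠ x : ℕ in atTop, (1 / 2 : ℝ) ≤ (Nat.primeCounting x : ℝ) * Real.log x / x :=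
    tendsto_primeCounting_mul_log_div.eventually (eventually_ge_nhds (by norm_num))
  refine IsBigO.of_bound 2 ?_
  filter_upwards [hev, eventually_ge_atTop 3] with x h1 h3
  have hx0 : (0 : ℝ) < x := by exact_mod_cast (show 0 < x by omega)
  have h3' : (3 : ℝ) ≤ x := by exact_mod_cast h3
  have hlog1 : 1 ≤ Real.log x := by
    rw [Real.le_log_iff_exp_le hx0]
    have := Real.exp_one_lt_d9
    linarith
  have hlogpos : 0 < Real.log x := by linarith
  have hπ : (0 : ℝ) ≤ (Nat.primeCounting x : ℝ) := Nat.cast_nonneg _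
  rw [Real.norm_eq_abs, Real.norm_eq_abs, abs_of_nonneg (by positivity), abs_of_nonneg hπ]
  have h2 : (1 / 2 : ℝ) * x ≤ (Nat.primeCounting x : ℝ) * Real.log x := (le_div_iff₀ hx0).mp h1
  calc (x : ℝ) / Real.log x ^ 2 ≤ (x : ℝ) / Real.log x := by
        apply div_le_div_of_nonneg_left hx0.le hlogpos
        nlinarith
    _ ≤ 2 * (Nat.primeCounting x : ℝ) := by
        rw [div_le_iff₀ hlogpos, mul_assoc]
        linarith

/-- **K1 dominates the open folklore conjecture at shift `h = 2`.**
`MoebiusShiftedPrimesLevel → (∑_{p ≤ X} μ(p + 2) = o(π(X)))`, i.e. the `h = 2` instance of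
`Literature.NumberTheory.Sieve.MoebiusShiftedPrimesConjecture` ([status: open] for every fixed
shift; Lichtman 2020, Thm 1.1 proves only the average over shifts). Any proof of K1 proves this open
statement; the witness is the single modulus `m = 1`, so lowering the level `0.499` does not help.
[folklore] -/
theorem moebiusShiftedPrimesConjecture_two_of_moebiusShiftedPrimesLevel
    (h : MoebiusShiftedPrimesLevel) :
    (fun X : ℕ => moebiusShiftedPrimeSum 2 X) =o[atTop] fun X : ℕ => (Nat.primeCounting X : ℝ) :=
  (isLittleO_moebiusShiftedPrimeSum_two_of_moebiusShiftedPrimesLevel h).trans_isBigO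
    isBigO_div_log_sq_primeCounting

end Summit.Parity.GeneralizedHardyLittlewood.Theorems.MoebiusShiftedPrimesLevel.Negative

end
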